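import Summits.SmoothPoincare4.SmoothPoincare4.Theorems.SymplecticOrigamiGromovRecognitionRelEndJSphereEssential
import Summits.SmoothPoincare4.SmoothPoincare4.Theorems.SymplecticOrigamiGromovRecognitionRelEndGluedBasics
import Literature.AlgebraicTopology.SingularHomology.HOneProducts

/-!
# A non-constant `JX`-sphere inside-or-disjoint from both wedge spheres is impossible
(registered helper `helper_sphereTrappedConst` of line `cross-cap-laurent`, crux
`GromovRecognitionRelEnd`, item stmt-SmoothPoincare4-11009)

Setting: `X` is the compact wedge cap of the crux, `ωX` a closed smooth 2-form taming the almost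
complex structure `JX`, and `KH`, `KV ⊆ X` the two wedge spheres at infinity, meeting exactly in
the corner `c₀` (`KH ∩ KV = {c₀}`).  The lead's skeleton supplies three abstract inputs:

* *`π₂` off the wedge*: a `JX`-holomorphic two-chart sphere `(u', v')` (`v' z = u' z⁻¹`) missing
  `KH ∪ KV` is constant;
* *punctured wedge spheres are contractible in `X`*: a continuous `G' : ℂℙ¹ → X` with range in
  `KH ∖ {c₀}` (resp. `KV ∖ {c₀}`) is homotopic to a constant map.

CLAIM (`helper_sphereTrappedConst`): a NON-CONSTANT `JX`-two-chart sphere `(u, v)` with glued map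
`G : C(ℂℙ¹, X)` which is inside-or-disjoint from `KH` and inside-or-disjoint from `KV` does not
exist.  The four cases:

* inside both: every `u z ∈ KH ∩ KV = {c₀}`, so `u` is constant;
* disjoint from both: `u` is constant by the `π₂` hypothesis;
* inside `KH`, disjoint from `KV` (and symmetrically): `range G = range u ∪ {v 0}`
  (`helper_gluedRange`, landed) lies in `KH ∖ KV ⊆ KH ∖ {c₀}` (`c₀ ∈ KV`), so `G` is
  null-homotopic, hence `G_* = const_* = 0` on `H₂(·; ℝ)` (homotopy invariance and
  `singularHomology.map_const`); but by the landed energy identity `helper_jSphereEssential`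
  (McDuff–Salamon, *J-holomorphic curves and symplectic topology*, §4.5 (4.5.4)) the Kronecker
  pairing `⟨e_X [ωX], G_* [ℂℙ¹]⟩` is non-zero for a non-constant `JX`-sphere — contradiction.

Nothing geometric is proved here: the file is the case analysis gluing the two landed helpers to
the abstract hypotheses.
-/

-- the prescribed namespace `Summit.<P>.<Sub>.…` duplicates `SmoothPoincare4` (P = Sub)
set_option linter.dupNamespace false

open scoped Manifold ContDiff Topology
open Set Function
open Literature.Topology.FourManifolds Literature.Topology.FourManifolds.ComplexProjectiveSpace
open Literature.Geometry.Kaehler Literature.Geometry.Symplectic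
open Literature.AlgebraicTopology.SingularHomology

namespace Summit.SmoothPoincare4.SmoothPoincare4.Theorems.GromovRecognitionRelEnd.CrossCapLaurent

/-- **A null-homotopic non-constant `JX`-sphere is impossible** (the homological core of
`helper_sphereTrappedConst`): if the glued map `G` of a non-constant `JX`-holomorphic two-chart
sphere `(u, v)`, `JX` tamed by the closed smooth 2-form `ωX`, is homotopic to a constant map, we get
a contradiction — `G_* = const_* = 0` on `H₂(·; ℝ)` (Hatcher 2002, Thm. 2.10 and Prop. 2.8), while
`⟨e_X [ωX], G_* [ℂℙ¹]⟩ ≠ 0` by the energy identity (`helper_jSphereEssential`).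
[cite: McDuffSalamon2017, §4.5 eq. (4.5.4)] -/
theorem sphereTrappedConst_not_homotopic_const {X : Type} [TopologicalSpace X] [T2Space X]
    [SecondCountableTopology X] [CompactSpace X] [ChartedSpace (EuclideanSpace ℝ (Fin 4)) X]
    [IsManifold (𝓡 4) ∞ X] {ωX : MForm (𝓡 4) X ℝ 2} {JX : AlmostComplexStructure (𝓡 4) ∞ X}
    {u v : ℂ → X} {G : C(ComplexProjectiveSpace 1, X)} (hs : IsSmoothForm ωX)
    (hc : IsClosedForm ωX) (ht : JX.IsTamedBy ωX) (hu : ContMDiff 𝓘(ℝ, ℂ) (𝓡 4) ∞ u)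
    (hv : ContMDiff 𝓘(ℝ, ℂ) (𝓡 4) ∞ v) (huv : ∀ z : ℂ, z ≠ 0 → v z = u z⁻¹)
    (hJu : IsJHolomorphic (𝓡 4) (fun y => JX y) u) (hJv : IsJHolomorphic (𝓡 4) (fun y => JX y) v)
    (hG0 : ∀ p, CoordNeZero 0 p → G p = u (affineCoordComplex 0 p 0))
    (hG1 : ∀ p, CoordNeZero 1 p → G p = v (affineCoordComplex 1 p 0)) (hne : ∃ z, u z ≠ u 0)
    {y : X} (hy : G.Homotopic (ContinuousMap.const _ y)) : False := by
  have hess := helper_jSphereEssential X ωX JX u v G G.continuous hs hc ht hu hv huv hJu hJv hG0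
    hG1 hne
  have hG : (⟨G, G.continuous⟩ : C(ComplexProjectiveSpace 1, X)) = G := rfl
  have hzero : singularHomology.map ℝ ℝ (⟨G, G.continuous⟩ : C(ComplexProjectiveSpace 1, X))
      (2 * 1) = 0 := by
    rw [hG, singularHomology.map_eq_of_homotopic ℝ ℝ hy]
    exact singularHomology.map_const ℝ ℝ y (by norm_num)
  rw [hzero] at hess
  exact hess (by simp)

/-- **Registered helper `helper_sphereTrappedConst`: a non-constant `JX`-sphere of the wedge cap
which is inside-or-disjoint from each of the two wedge spheres `KH`, `KV` (`KH ∩ KV = {c₀}`) cannot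
exist.**  Inside both: `u` takes values in `KH ∩ KV = {c₀}`, so is constant.  Disjoint from both:
constant by the `π₂`-off-the-wedge hypothesis.  Inside one and disjoint from the other: the glued
range `range u ∪ {v 0}` (`helper_gluedRange`) lies in the punctured wedge sphere, so the glued map
is null-homotopic, contradicting `sphereTrappedConst_not_homotopic_const` (energy of non-constant
`J`-spheres, McDuff–Salamon 2017, §4.5 (4.5.4)). [cite: McDuffSalamon2017, §4.5 eq. (4.5.4)] -/
theorem helper_sphereTrappedConst : ∀ (X : Type) [TopologicalSpace X] [T2Space X] [SecondCountableTopology X] [CompactSpace X] [ChartedSpace (EuclideanSpace ℝ (Fin 4)) X] [IsManifold (𝓡 4) ∞ X] (ωX : MForm (𝓡 4) X ℝ 2) (JX : AlmostComplexStructure (𝓡 4) ∞ X) (KH KV : Set X) (c₀ : X) (u v : ℂ → X) (G : C(ComplexProjectiveSpace 1, X)), IsSmoothForm ωX → IsClosedForm ωX → JX.IsTamedBy ωX → KH ∩ KV = {c₀} → (∀ u' v' : ℂ → X, ContMDiff 𝓘(ℝ, ℂ) (𝓡 4) ∞ u' → ContMDiff 𝓘(ℝ, ℂ) (𝓡 4)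 ∞ v' → (∀ z : ℂ, z ≠ 0 → v' z = u' z⁻¹) → IsJHolomorphic (𝓡 4) (fun y => JX y) u' → IsJHolomorphic (𝓡 4) (fun y => JX y) v' → (∀ z, u' z ∉ KH ∪ KV) → v' 0 ∉ KH ∪ KV → ∀ z, u' z = u' 0) → (∀ G' : C(ComplexProjectiveSpace 1, X), Set.range G' ⊆ KH \ {c₀} → ∃ y : X, G'.Homotopic (ContinuousMap.const _ y)) → (∀ G' : C(ComplexProjectiveSpace 1, X), Set.range G' ⊆ KV \ {c₀} → ∃ y : X, G'.Homotopic (ContinuousMap.const _ y)) → ContMDiff 𝓘(ℝ, ℂ) (𝓡 4) ∞ u → ContMDiff 𝓘(ℝ, ℂ) (𝓡 4) ∞ v → (∀ z : ℂ, z ≠ 0 → v z = u z⁻¹) → IsJHolomorphic (𝓡 4) (fun y => JX y) u → IsJHolomorphic (𝓡 4) (fun y => JX y) v → (∀ p, CoordNeZero 0 p → G p = u (affineCoordComplex 0 p 0)) → (∀ p, CoordNeZero 1 p → G p = v (affineCoordComplex 1 p 0)) → (∃ z, u z ≠ u 0) → (((∀ z, u z ∈ KH) ∧ v 0 ∈ KH)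 ∨ ((∀ z, u z ∉ KH) ∧ v 0 ∉ KH)) → (((∀ z, u z ∈ KV) ∧ v 0 ∈ KV) ∨ ((∀ z, u z ∉ KV) ∧ v 0 ∉ KV)) → False := by
  intro X _ _ _ _ _ _ ωX JX KH KV c₀ u v G hs hc ht hKHV hπ hnH hnV hu hv huv hJu hJv hG0 hG1 hne
    hH hV
  -- the corner lies on both wedge spheres
  have hc₀ : c₀ ∈ KH ∩ KV := by
    rw [hKHV]
    exact Set.mem_singleton c₀
  -- the range of the glued map
  have hrange : Set.range G = Set.range u ∪ {v 0} := helper_gluedRange X u v G huv hG0 hG1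
  rcases hH with ⟨huH, hvH⟩ | ⟨huH, hvH⟩ <;> rcases hV with ⟨huV, hvV⟩ | ⟨huV, hvV⟩
  · -- inside both wedge spheres: `u` takes the single value `c₀`
    obtain ⟨z, hz⟩ := hne
    have h1 : u z ∈ KH ∩ KV := ⟨huH z, huV z⟩
    have h2 : u 0 ∈ KH ∩ KV := ⟨huH 0, huV 0⟩
    rw [hKHV, Set.mem_singleton_iff] at h1 h2
    exact hz (h1.trans h2.symm)
  · -- inside `KH`, disjoint from `KV`: the glued map lands in the punctured sphere `KH ∖ {c₀}`
    have hsub : Set.range G ⊆ KH \ {c₀} := by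
      rw [hrange]
      rintro x (⟨z, rfl⟩ | hx)
      · exact ⟨huH z, fun h => huV z (by rw [Set.mem_singleton_iff.1 h]; exact hc₀.2)⟩
      · rw [Set.mem_singleton_iff.1 hx]
        exact ⟨hvH, fun h => hvV (by rw [Set.mem_singleton_iff.1 h]; exact hc₀.2)⟩
    obtain ⟨y, hy⟩ := hnH G hsub
    exact sphereTrappedConst_not_homotopic_const hs hc ht hu hv huv hJu hJv hG0 hG1 hne hy
  · -- disjoint from `KH`, inside `KV`: the glued map lands in the punctured sphere `KV ∖ {c₀}`
    have hsub : Set.range G ⊆ KV \ {c₀} := by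
      rw [hrange]
      rintro x (⟨z, rfl⟩ | hx)
      · exact ⟨huV z, fun h => huH z (by rw [Set.mem_singleton_iff.1 h]; exact hc₀.1)⟩
      · rw [Set.mem_singleton_iff.1 hx]
        exact ⟨hvV, fun h => hvH (by rw [Set.mem_singleton_iff.1 h]; exact hc₀.1)⟩
    obtain ⟨y, hy⟩ := hnV G hsub
    exact sphereTrappedConst_not_homotopic_const hs hc ht hu hv huv hJu hJv hG0 hG1 hne hy
  · -- disjoint from both wedge spheres: constant by `π₂` off the wedge
    obtain ⟨z, hz⟩ := hne
    exact hz (hπ u v hu hv huv hJu hJv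
      (fun w hw => ((Set.mem_union _ _ _).1 hw).elim (huH w) (huV w))
      (fun hw => ((Set.mem_union _ _ _).1 hw).elim hvH hvV) z)

end Summit.SmoothPoincare4.SmoothPoincare4.Theorems.GromovRecognitionRelEnd.CrossCapLaurent
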